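import Summits.BirchSwinnertonDyer.BirchSwinnertonDyer.Theorems.Rank1ResidualX1Defs
import Literature.NumberTheory.EllipticCurves.Rank1Residual.X10MainConjecture

/-!
# Rank-≤1 BSD residual class X10a′ ∩ {r = 0}: prover A's `MazurMainConjecture W 3` ⟺ `BSDp W 3` — the surjective-image twin of `Rank1ResidualX1Converse`

HONEST FRAMING (cell `b2b-bsdres`, home `run/shared/lean/b2b/bsd-rank1-residual/`, unit
`b2b-bsdres-x10`, X10 prover, gen 5). The goal is to DELETE the COMBINATION-SHAPED residual classes
for ALL analytic-rank `≤ 1` curves over `ℚ` — "full BSD formula for every rank `≤ 1` curve in class C"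
assembled STRICTLY from published theorems — so that the rank-`≤ 1` remainder becomes exactly the
CONSTRUCTION-SHAPED classes, which are TYPED (missing-input `Prop`s), NOT attempted; this is not
"finishing BSD". Helper file of the crux `PAdicOrderMainConjectureR5` (stmt-BirchSwinnertonDyer-15418,
the cyclotomic main conjecture at good ordinary `p`), companion of `Rank1ResidualX1Defs` (prover A's
typed `MazurMainConjecture W p`) and of `Rank1ResidualX1Converse` (prover B, the reducible case).

Theorems only, in prover A's vocabulary, from the Literature file
`Rank1Residual/X10MainConjecture.lean` (this unit): on X10a′ = X10 ∧ surj(3) (`p = 3` good ordinary,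
mod-`3` image all of `GL₂(𝔽₃)`, hence `ρ_{E,3^∞}` surjective by Wuthrich 2014 Lemma 20) at analytic
rank `0`, Kato's INTEGRAL divisibility (Astérisque 295, Thm. 17.4 (3)) and Greenberg's Thm. 4.1 make
the cofactor of `L_p = ι(h · f_E)` a unit of `Λ` exactly when the two sides of the rank-`0` BSD
formula have the same `3`-adic valuation:

* `X10.mazurMainConjecture_iff_bsdp_three` — `ClassX10 W 3 → Surj W 3 → r_an = 0 →
  (MazurMainConjecture W 3 ↔ BSDp W 3)`, granted the PUBLISHED named facts Kato Thm. 17.4 (3)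
  (`kato_divisibility`, for the newform of level `N_E` and every cyclotomic datum), Greenberg Thm. 4.1
  (`greenberg_charValue_rankZero`), modularity (`nonempty_modularParametrizationData`),
  Gross–Zagier–Kolyvagin, Wuthrich Lemma 20 (`lemma20_surjective_threeAdic_of_semistable`) and the
  inline period unit `hϖ` (as in `Rank1ResidualX9RankZero`);
* `X10.mazurMainConjecture_iff_missingLowerBoundAt_three` — the same with the cell's typed lower
  bound `Typed.MissingLowerBoundAt W 3` on the right: WITHOUT Yan–Zhu 2026 (flag
  `YZ26@3-BF-ERL-Ohta`) the missing input of X10a′ ∧ r = 0 IS `MazurMainConjecture W 3`;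
* `X10.mazurMainConjecture_three_of_shaAn_unit`,
  `X10.mazurMainConjecture_three_of_casselsTate_of_three_dvd` — per pair: `MazurMainConjecture W 3`
  is a THEOREM of the published record (+ the lane's exact `#Ш_an`, resp. + a `3`-descent certificate
  `3 ∣ #Ш`) at every rank-`0` X10a′ census pair (`N < 2·10⁴`: 12 with `#Ш_an = 1`, 4 with
  `#Ш_an = 9`) — surjective image, no ramified multiplicative prime: outside Skinner–Urban 2014
  Thm. 3.6.9, and inside Yan–Zhu 2026 Thm. 4.9 only with the flag.

References: [Kato2004Asterisque] Thm. 17.4 (3); [GreenbergLNM1716] Thm. 4.1, §5 (closing examples);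
[Wuthrich2014] Lemma 20, Prop. 21; [CastellaEtAl2021] Thm. 5.1.4; [SkinnerUrban2014] Thm. 3.6.9;
[Miller2011LMS] Def. 1.1; cell file X10-AUDIT.md §11.
-/

noncomputable section

open scoped Classical MatrixGroups ModularForm

open CongruenceSubgroup WeierstrassCurve Literature.NumberTheory.EllipticCurves
  Literature.NumberTheory.EllipticCurves.ModularForms Literature.NumberTheory.EllipticCurves.Rank1Residual
  Literature.NumberTheory.EllipticCurves.Rank1Residual.Typed
  Literature.NumberTheory.EllipticCurves.Wuthrich2014
  Summit.BirchSwinnertonDyer.BirchSwinnertonDyer.Theorems.Rank1ResidualX1Defs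

set_option linter.dupNamespace false
set_option autoImplicit false

namespace Summit.BirchSwinnertonDyer.BirchSwinnertonDyer.Theorems.Rank1ResidualX10MainConjecture

variable (W : WeierstrassCurve ℚ) [W.IsElliptic] [W.IsGloballyMinimal]

/-- **X10a′ ∩ {r = 0}: prover A's typed input IS Miller's `BSD(E,3)`, pair by pair.** For `W/ℚ`
globally minimal elliptic with `ClassX10 W 3`, `Surj W 3` and `ord_{s=1} L(E,s) = 0`, granted the
PUBLISHED named facts Kato Thm. 17.4 (3) (`hK`), Greenberg Thm. 4.1 (`hGr`), modularity (`hmod`),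
Gross–Zagier–Kolyvagin (`hGZK`), Wuthrich Lemma 20 (`hW20`) and the inline period unit (`hϖ`):
`MazurMainConjecture W 3 ↔ BSDp W 3` (`Rank1Residual.X10.mainConjecture_iff_bsdp_three_of_surj`).
[cite: Kato2004Asterisque, Thm. 17.4 (3) (p. 273)] [cite: GreenbergLNM1716, Thm. 4.1 and §5 (closing examples)]
[cite: Wuthrich2014, Lemma 20 (p. 400)] -/
theorem X10.mazurMainConjecture_iff_bsdp_three (hGr : greenberg_charValue_rankZero)
    (hmod : nonempty_modularParametrizationData)
    (hGZK : rank_eq_analyticRank_of_analyticRank_le_one)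
    (hW20 : lemma20_surjective_threeAdic_of_semistable)
    (hK : ∀ (κ : ZpExtension ℚ 3) (γ : Field.absoluteGaloisGroup ℚ) [NeZero (W.conductorNorm ℤ)]
      (f : CuspForm (Gamma0 (W.conductorNorm ℤ)) 2), kato_divisibility W 3 (κ := κ) (γ := γ) (f := f))
    (hϖ : ∀ [NeZero (W.conductorNorm ℤ)] (f : CuspForm (Gamma0 (W.conductorNorm ℤ)) 2),
      IsNewformOf W f → ∀ ϖ : ℚ, (ϖ : ℝ) * W.realPeriodRat = plusPeriod f → padicValRat 3 ϖ = 0)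
    (hX : ClassX10 W 3) (hsurj : Surj W 3) (hr0 : W.analyticRank = 0) :
    MazurMainConjecture W 3 ↔ BSDp W 3 :=
  Rank1Residual.X10.mainConjecture_iff_bsdp_three_of_surj W hGr hmod hGZK hW20 hK hϖ hX hsurj hr0

/-- **X10a′ ∩ {r = 0}: prover A's typed input ⟺ the cell's typed lower bound
`Typed.MissingLowerBoundAt W 3`** (`ord_3 #Ш(E/ℚ)_an ≤ ord_3 #Ш(E/ℚ)`), same facts — i.e. WITHOUT the
Yan–Zhu fact the missing input on the rank-`0` branch of X10a′ is exactly `MazurMainConjecture W 3`.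
[cite: Kato2004Asterisque, Thm. 17.4 (3) (p. 273)] [cite: GreenbergLNM1716, Thm. 4.1 and §5 (closing examples)]
[cite: Wuthrich2014, Lemma 20 and Prop. 21 (p. 400)] -/
theorem X10.mazurMainConjecture_iff_missingLowerBoundAt_three (hGr : greenberg_charValue_rankZero)
    (hmod : nonempty_modularParametrizationData)
    (hGZK : rank_eq_analyticRank_of_analyticRank_le_one)
    (hW20 : lemma20_surjective_threeAdic_of_semistable)
    (hK : ∀ (κ : ZpExtension ℚ 3) (γ : Field.absoluteGaloisGroup ℚ) [NeZero (W.conductorNorm ℤ)]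
      (f : CuspForm (Gamma0 (W.conductorNorm ℤ)) 2), kato_divisibility W 3 (κ := κ) (γ := γ) (f := f))
    (hϖ : ∀ [NeZero (W.conductorNorm ℤ)] (f : CuspForm (Gamma0 (W.conductorNorm ℤ)) 2),
      IsNewformOf W f → ∀ ϖ : ℚ, (ϖ : ℝ) * W.realPeriodRat = plusPeriod f → padicValRat 3 ϖ = 0)
    (hX : ClassX10 W 3) (hsurj : Surj W 3) (hr0 : W.analyticRank = 0) :
    MazurMainConjecture W 3 ↔ MissingLowerBoundAt W 3 :=
  Rank1Residual.X10.mainConjecture_iff_missingLowerBoundAt_three_of_surj W hGr hmod hGZK hW20 hK hϖ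
    hX hsurj hr0

/-- **Per pair, PUBLISHED inputs + the lane's exact `#Ш_an` with `3 ∤ #Ш_an`:
`MazurMainConjecture W 3`** on X10a′ ∩ {r = 0} (lever L1, Wuthrich Prop. 21, `hW`; analytic
continuation `hmodL`). [cite: Wuthrich2014, Prop. 21 and Lemma 20 (p. 400)]
[cite: Kato2004Asterisque, Thm. 17.4 (3) (p. 273)] [cite: GreenbergLNM1716, §5 (closing examples)] -/
theorem X10.mazurMainConjecture_three_of_shaAn_unit (hGr : greenberg_charValue_rankZero)
    (hmod : nonempty_modularParametrizationData) (hmodL : hasEntireLFunction_rat)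
    (hGZK : rank_eq_analyticRank_of_analyticRank_le_one) (hW : sha_dvd_analyticSha)
    (hW20 : lemma20_surjective_threeAdic_of_semistable)
    (hK : ∀ (κ : ZpExtension ℚ 3) (γ : Field.absoluteGaloisGroup ℚ) [NeZero (W.conductorNorm ℤ)]
      (f : CuspForm (Gamma0 (W.conductorNorm ℤ)) 2), kato_divisibility W 3 (κ := κ) (γ := γ) (f := f))
    (hϖ : ∀ [NeZero (W.conductorNorm ℤ)] (f : CuspForm (Gamma0 (W.conductorNorm ℤ)) 2),
      IsNewformOf W f → ∀ ϖ : ℚ, (ϖ : ℝ) * W.realPeriodRat = plusPeriod f → padicValRat 3 ϖ = 0)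
    (hX : ClassX10 W 3) (hsurj : Surj W 3) (hr0 : W.analyticRank = 0)
    (hunit : ∃ q : ℚ, shaAn W = (q : ℂ) ∧ padicValRat 3 q = 0) : MazurMainConjecture W 3 :=
  Rank1Residual.X10.mainConjecture_three_of_surj_of_shaAn_unit W hGr hmod hmodL hGZK hW hW20 hK hϖ hX
    hsurj hr0 hunit

/-- **Per pair, PUBLISHED inputs + `ord_3 #Ш_an ≤ 2` + a certificate `3 ∣ #Ш(E/ℚ)`:
`MazurMainConjecture W 3`** on X10a′ ∩ {r = 0} (Wuthrich Prop. 21 `hW` + Cassels–Tate `hCT`; the four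
`#Ш_an = 9` census pairs `9800i1`, `15376i1`, `15376k1`, `15488h1` at `3`).
[cite: Wuthrich2014, Prop. 21 (p. 400)] [cite: SilvermanAEC2009, Thm. X.4.14]
[cite: Kato2004Asterisque, Thm. 17.4 (3) (p. 273)] -/
theorem X10.mazurMainConjecture_three_of_casselsTate_of_three_dvd (hGr : greenberg_charValue_rankZero)
    (hmod : nonempty_modularParametrizationData) (hmodL : hasEntireLFunction_rat)
    (hGZK : rank_eq_analyticRank_of_analyticRank_le_one)
    (hCT : exists_casselsTate_pairing (K := ℚ)) (hW : sha_dvd_analyticSha)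
    (hW20 : lemma20_surjective_threeAdic_of_semistable)
    (hK : ∀ (κ : ZpExtension ℚ 3) (γ : Field.absoluteGaloisGroup ℚ) [NeZero (W.conductorNorm ℤ)]
      (f : CuspForm (Gamma0 (W.conductorNorm ℤ)) 2), kato_divisibility W 3 (κ := κ) (γ := γ) (f := f))
    (hϖ : ∀ [NeZero (W.conductorNorm ℤ)] (f : CuspForm (Gamma0 (W.conductorNorm ℤ)) 2),
      IsNewformOf W f → ∀ ϖ : ℚ, (ϖ : ℝ) * W.realPeriodRat = plusPeriod f → padicValRat 3 ϖ = 0)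
    (hX : ClassX10 W 3) (hsurj : Surj W 3) (hr0 : W.analyticRank = 0)
    {q : ℚ} (hq : shaAn W = (q : ℂ)) (hv : padicValRat 3 q ≤ 2) (hdvd : 3 ∣ W.shaOrder) :
    MazurMainConjecture W 3 :=
  Rank1Residual.X10.mainConjecture_three_of_surj_of_casselsTate_of_three_dvd W hGr hmod hmodL hGZK hCT
    hW hW20 hK hϖ hX hsurj hr0 hq hv hdvd

end Summit.BirchSwinnertonDyer.BirchSwinnertonDyer.Theorems.Rank1ResidualX10MainConjecture

end
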